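import Mathlib.Analysis.Calculus.FDeriv.Basic
import Mathlib.Analysis.Normed.Operator.BoundedLinearMaps
import Literature.Analysis.Calculus.QuadraticFixedPoint
import HarnessLib

/-!
# The solution map of `w = A g − J Q(w, w)` near `g = 0` and its strict derivative

Analysis/Calculus support file (everything proved; no definitions, no named facts).  The
functional-analytic step behind "the solution operator of a semilinear integral equation with a
quadratic nonlinearity is `C¹` in the datum, with derivative the solution operator of the
linearised equation": for Banach spaces `G` (data), `X` (solutions), bounded linear
`A : G → X`, `J : X → X` and bounded bilinear `Q : X × X → X`, the equation

  `w = A g − J (Q w w)`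

has, for `‖g‖ < r`, a unique solution `w = sol g` in a fixed ball `‖w‖ ≤ ρ` (Banach fixed point:
`w ↦ A g − J Q(w,w)` is a `½`-contraction of the ball), with `sol 0 = 0`,
`‖sol g₁ − sol g₂‖ ≤ 2‖A‖ ‖g₁ − g₂‖`, and — the point of the file —

  `HasStrictFDerivAt sol A 0`,

because `sol g₁ − sol g₂ − A(g₁ − g₂) = −J(Q w₁ w₁ − Q w₂ w₂)` is bounded by
`‖J‖‖Q‖(‖w₁‖ + ‖w₂‖)‖w₁ − w₂‖ = O((‖g₁‖ + ‖g₂‖)‖g₁ − g₂‖)`.  (In the application `X` is a space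
of bounded continuous space–time fields on a short time window, `A = (1 + L)⁻¹ e^{(t−s)Δ}`,
`J = (1 + L)⁻¹` with `L` the linearisation of the Oseen bilinear term at the background, and
`Q` the Oseen bilinear term; the window maps of the Navier–Stokes flow are then strictly
differentiable at the background with derivative the linearised flow, and the chain rule gives
the period map.)  This is the standard contraction-mapping proof of smooth dependence on data
(e.g. Henry, *Geometric Theory of Semilinear Parabolic Equations*, LNM 840, Thm. 3.4.4;
Chodosh–Shlapentokh-Rothman 2017, Lemma 4.0.3 for the quadratic fixed point itself, the tree's
`exists_quadraticSolutionMap`); only the norms and Banach's fixed point theorem are used.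

## Mathlib / tree search

Tree: `Literature.Analysis.Calculus.exists_isFixedPt_mem_closedBall` (Banach fixed point on a
closed ball).  Mathlib: `HasStrictFDerivAt`, `hasStrictFDerivAt_iff_isLittleO`,
`Asymptotics.isLittleO_iff`, `ContinuousLinearMap.le_opNorm₂`.

## References

* D. Henry, *Geometric Theory of Semilinear Parabolic Equations*, LNM 840 (1981), §3.4
  (differentiable dependence on initial data via the contraction mapping principle). [Henry1981]
* O. Chodosh, Y. Shlapentokh-Rothman, Comm. Math. Phys. 356 (2017), Lemma 4.0.3.
  [ChodoshShlapentokhrothman2017]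
-/

noncomputable section

open Set Metric Filter Asymptotics Function
open _root_.Topology

namespace Literature.Analysis.Calculus

variable {G X : Type*} [NormedAddCommGroup G] [NormedSpace ℝ G]
  [NormedAddCommGroup X] [NormedSpace ℝ X] [CompleteSpace X]

omit [CompleteSpace X] in
/-- The quadratic map `w ↦ Q w w` is locally Lipschitz with constant `‖Q‖(‖w₁‖ + ‖w₂‖)`:
`Q w₁ w₁ − Q w₂ w₂ = Q w₁ (w₁ − w₂) + Q (w₁ − w₂) w₂`. [folklore] -/
theorem norm_bilinear_diag_sub_le (Q : X →L[ℝ] X →L[ℝ] X) (w₁ w₂ : X) :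
    ‖Q w₁ w₁ - Q w₂ w₂‖ ≤ ‖Q‖ * (‖w₁‖ + ‖w₂‖) * ‖w₁ - w₂‖ := by
  have hsplit : Q w₁ w₁ - Q w₂ w₂ = Q w₁ (w₁ - w₂) + Q (w₁ - w₂) w₂ := by
    simp only [map_sub, _root_.sub_apply]; abel
  rw [hsplit]
  calc ‖Q w₁ (w₁ - w₂) + Q (w₁ - w₂) w₂‖ ≤ ‖Q w₁ (w₁ - w₂)‖ + ‖Q (w₁ - w₂) w₂‖ := norm_add_le _ _
    _ ≤ ‖Q‖ * ‖w₁‖ * ‖w₁ - w₂‖ + ‖Q‖ * ‖w₁ - w₂‖ * ‖w₂‖ :=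
        add_le_add (Q.le_opNorm₂ _ _) (Q.le_opNorm₂ _ _)
    _ = ‖Q‖ * (‖w₁‖ + ‖w₂‖) * ‖w₁ - w₂‖ := by ring

/-- **The solution map of `w = A g − J Q(w,w)` and its strict derivative at `0`.**  For bounded
linear `A : G →L X`, `J : X →L X` and bounded bilinear `Q` on a Banach space `X` there are radii
`r, ρ > 0` and a map `sol : G → X` such that: `sol 0 = 0`; for `‖g‖ < r`, `sol g` solves the
equation and `‖sol g‖ ≤ ρ`; it is the only solution in that ball; `sol` is `2‖A‖`-Lipschitz on the
`r`-ball (in particular `‖sol g‖ ≤ 2‖A‖‖g‖`); and `sol` is strictly differentiable at `0` with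
derivative `A`.  Proof: with `ρ = 1/(4(‖J‖‖Q‖ + 1))` and `r = ρ/(2(‖A‖ + 1))` the map
`w ↦ A g − J Q(w,w)` maps `B̄(0, ρ)` into itself and is a `½`-contraction there; the remaining
assertions follow from `‖J(Q w₁ w₁ − Q w₂ w₂)‖ ≤ ‖J‖‖Q‖(‖w₁‖ + ‖w₂‖)‖w₁ − w₂‖`.
(Henry 1981, §3.4; Chodosh–Shlapentokh-Rothman 2017, Lemma 4.0.3.) [cite: Henry1981, Thm 3.4.4] -/
theorem exists_solutionMap_hasStrictFDerivAt (A : G →L[ℝ] X) (J : X →L[ℝ] X)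
    (Q : X →L[ℝ] X →L[ℝ] X) :
    ∃ r : ℝ, 0 < r ∧ ∃ ρ : ℝ, 0 < ρ ∧ ∃ sol : G → X,
      sol 0 = 0 ∧
      (∀ g, ‖g‖ < r → ‖sol g‖ ≤ ρ ∧ sol g = A g - J (Q (sol g) (sol g))) ∧
      (∀ g w, ‖g‖ < r → ‖w‖ ≤ ρ → w = A g - J (Q w w) → w = sol g) ∧
      (∀ g₁ g₂, ‖g₁‖ < r → ‖g₂‖ < r → ‖sol g₁ - sol g₂‖ ≤ 2 * ‖A‖ * ‖g₁ - g₂‖) ∧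
      (∀ g, ‖g‖ < r → ‖sol g‖ ≤ 2 * ‖A‖ * ‖g‖) ∧
      HasStrictFDerivAt sol A 0 := by
  classical
  set a : ℝ := ‖A‖ with ha
  set j : ℝ := ‖J‖ with hj
  set q : ℝ := ‖Q‖ with hq
  have ha0 : 0 ≤ a := norm_nonneg A
  have hj0 : 0 ≤ j := norm_nonneg J
  have hq0 : 0 ≤ q := norm_nonneg Q
  set ρ : ℝ := 1 / (4 * (j * q + 1)) with hρ
  have hρ0 : 0 < ρ := by positivity
  have hjqρ : j * q * ρ ≤ 1 / 4 := by
    rw [hρ, mul_one_div, div_le_iff₀ (by positivity)]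
    nlinarith
  set r : ℝ := ρ / (2 * (a + 1)) with hr
  have hr0 : 0 < r := by positivity
  have har : a * r ≤ ρ / 2 := by
    rw [hr]
    rw [mul_div_assoc']
    rw [div_le_div_iff₀ (by positivity) (by positivity)]
    nlinarith
  -- the contraction `Φ g w = A g − J (Q w w)` on the closed ball of radius `ρ`
  set Φ : G → X → X := fun g w => A g - J (Q w w) with hΦ
  have hΦlip : ∀ g w₁ w₂, ‖w₁‖ ≤ ρ → ‖w₂‖ ≤ ρ →
      ‖Φ g w₁ - Φ g w₂‖ ≤ (1 / 2) * ‖w₁ - w₂‖ := by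
    intro g w₁ w₂ hw₁ hw₂
    have h1 : Φ g w₁ - Φ g w₂ = -(J (Q w₁ w₁ - Q w₂ w₂)) := by
      simp only [hΦ, map_sub]; abel
    rw [h1, norm_neg]
    calc ‖J (Q w₁ w₁ - Q w₂ w₂)‖ ≤ j * ‖Q w₁ w₁ - Q w₂ w₂‖ := J.le_opNorm _
      _ ≤ j * (q * (‖w₁‖ + ‖w₂‖) * ‖w₁ - w₂‖) := by
          gcongr; exact norm_bilinear_diag_sub_le Q w₁ w₂
      _ = (j * q * (‖w₁‖ + ‖w₂‖)) * ‖w₁ - w₂‖ := by ring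
      _ ≤ (j * q * (ρ + ρ)) * ‖w₁ - w₂‖ := by gcongr
      _ = (2 * (j * q * ρ)) * ‖w₁ - w₂‖ := by ring
      _ ≤ (2 * (1 / 4)) * ‖w₁ - w₂‖ := by gcongr
      _ = (1 / 2) * ‖w₁ - w₂‖ := by ring
  have hΦmaps : ∀ g, ‖g‖ < r → MapsTo (Φ g) (closedBall 0 ρ) (closedBall 0 ρ) := by
    intro g hg w hw
    rw [mem_closedBall_zero_iff] at hw ⊢
    have hQ : ‖J (Q w w)‖ ≤ ρ / 4 := by
      calc ‖J (Q w w)‖ ≤ j * ‖Q w w‖ := J.le_opNorm _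
        _ ≤ j * (q * ‖w‖ * ‖w‖) := by gcongr; exact Q.le_opNorm₂ _ _
        _ = (j * q * ‖w‖) * ‖w‖ := by ring
        _ ≤ (j * q * ρ) * ρ := by gcongr
        _ ≤ (1 / 4) * ρ := by gcongr
        _ = ρ / 4 := by ring
    calc ‖Φ g w‖ ≤ ‖A g‖ + ‖J (Q w w)‖ := norm_sub_le _ _
      _ ≤ a * ‖g‖ + ρ / 4 := add_le_add (A.le_opNorm _) hQ
      _ ≤ a * r + ρ / 4 := by gcongr
      _ ≤ ρ / 2 + ρ / 4 := by gcongr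
      _ ≤ ρ := by linarith
  have hΦlipOn : ∀ g, LipschitzOnWith (1 / 2 : NNReal) (Φ g) (closedBall 0 ρ) := by
    intro g
    refine LipschitzOnWith.of_dist_le_mul fun w₁ hw₁ w₂ hw₂ => ?_
    rw [dist_eq_norm, dist_eq_norm]
    have := hΦlip g w₁ w₂ (mem_closedBall_zero_iff.1 hw₁) (mem_closedBall_zero_iff.1 hw₂)
    simpa using this
  -- existence of a fixed point in the ball, and uniqueness there
  have hex : ∀ g, ‖g‖ < r → ∃ w ∈ closedBall (0 : X) ρ, Φ g w = w := fun g hg =>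
    exists_isFixedPt_mem_closedBall hρ0.le (K := 1 / 2) (by norm_num) (hΦmaps g hg) (hΦlipOn g)
  have huniq : ∀ g w₁ w₂, ‖w₁‖ ≤ ρ → ‖w₂‖ ≤ ρ → Φ g w₁ = w₁ → Φ g w₂ = w₂ → w₁ = w₂ := by
    intro g w₁ w₂ hw₁ hw₂ h1 h2
    have h := hΦlip g w₁ w₂ hw₁ hw₂
    rw [h1, h2] at h
    have : ‖w₁ - w₂‖ ≤ 0 := by linarith [norm_nonneg (w₁ - w₂)]
    exact sub_eq_zero.1 (norm_le_zero_iff.1 this)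
  -- the solution map
  set sol : G → X := fun g => if hg : ‖g‖ < r then (hex g hg).choose else 0 with hsol
  have hsol_spec : ∀ g, ‖g‖ < r → ‖sol g‖ ≤ ρ ∧ Φ g (sol g) = sol g := by
    intro g hg
    have h := (hex g hg).choose_spec
    simp only [hsol, dif_pos hg]
    exact ⟨mem_closedBall_zero_iff.1 h.1, h.2⟩
  -- Lipschitz dependence on the datum
  have hLip : ∀ g₁ g₂, ‖g₁‖ < r → ‖g₂‖ < r → ‖sol g₁ - sol g₂‖ ≤ 2 * a * ‖g₁ - g₂‖ := by
    intro g₁ g₂ hg₁ hg₂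
    obtain ⟨hb₁, he₁⟩ := hsol_spec g₁ hg₁
    obtain ⟨hb₂, he₂⟩ := hsol_spec g₂ hg₂
    have hA' : Φ g₁ (sol g₂) - Φ g₂ (sol g₂) = A (g₁ - g₂) := by
      simp only [hΦ, map_sub]; abel
    have hsplit : sol g₁ - sol g₂ = (Φ g₁ (sol g₁) - Φ g₁ (sol g₂)) + A (g₁ - g₂) := by
      calc sol g₁ - sol g₂ = Φ g₁ (sol g₁) - Φ g₂ (sol g₂) := by rw [he₁, he₂]
        _ = (Φ g₁ (sol g₁) - Φ g₁ (sol g₂)) + (Φ g₁ (sol g₂) - Φ g₂ (sol g₂)) := by abel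
        _ = (Φ g₁ (sol g₁) - Φ g₁ (sol g₂)) + A (g₁ - g₂) := by rw [hA']
    have key : ‖sol g₁ - sol g₂‖ ≤ (1 / 2) * ‖sol g₁ - sol g₂‖ + a * ‖g₁ - g₂‖ := by
      have h3 := hΦlip g₁ (sol g₁) (sol g₂) hb₁ hb₂
      calc ‖sol g₁ - sol g₂‖ = ‖(Φ g₁ (sol g₁) - Φ g₁ (sol g₂)) + A (g₁ - g₂)‖ := by rw [← hsplit]
        _ ≤ ‖Φ g₁ (sol g₁) - Φ g₁ (sol g₂)‖ + ‖A (g₁ - g₂)‖ := norm_add_le _ _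
        _ ≤ (1 / 2) * ‖sol g₁ - sol g₂‖ + a * ‖g₁ - g₂‖ := add_le_add h3 (A.le_opNorm _)
    linarith
  have hsol0 : sol 0 = 0 := by
    have h0r : ‖(0 : G)‖ < r := by simpa using hr0
    obtain ⟨hb, he⟩ := hsol_spec 0 h0r
    have hfix0 : Φ 0 0 = 0 := by simp [hΦ]
    exact huniq 0 _ _ hb (by simpa using hρ0.le) he hfix0
  have hbound : ∀ g, ‖g‖ < r → ‖sol g‖ ≤ 2 * a * ‖g‖ := by
    intro g hg
    have h := hLip g 0 hg (by simpa using hr0)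
    simpa [hsol0] using h
  refine ⟨r, hr0, ρ, hρ0, sol, hsol0, fun g hg => ?_, fun g w hg hw hfix => ?_, hLip, hbound, ?_⟩
  · exact ⟨(hsol_spec g hg).1, (hsol_spec g hg).2.symm⟩
  · obtain ⟨hb, he⟩ := hsol_spec g hg
    exact huniq g w (sol g) hw hb hfix.symm he
  · -- strict differentiability at `0` with derivative `A`
    rw [hasStrictFDerivAt_iff_isLittleO, Asymptotics.isLittleO_iff]
    intro c hc
    -- near `(0, 0)` both components are in the `r`-ball and small
    set η : ℝ := min r (c / (8 * a ^ 2 * j * q + 1)) with hη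
    have hη0 : 0 < η := by positivity
    have hmem : Metric.ball (0 : G × G) η ∈ 𝓝 ((0 : G), (0 : G)) := Metric.ball_mem_nhds _ hη0
    filter_upwards [hmem] with p hp
    rw [mem_ball_zero_iff] at hp
    have hp1 : ‖p.1‖ < η := (norm_fst_le p).trans_lt hp
    have hp2 : ‖p.2‖ < η := (norm_snd_le p).trans_lt hp
    have hr1 : ‖p.1‖ < r := hp1.trans_le (min_le_left _ _)
    have hr2 : ‖p.2‖ < r := hp2.trans_le (min_le_left _ _)
    obtain ⟨hb₁, he₁⟩ := hsol_spec p.1 hr1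
    obtain ⟨hb₂, he₂⟩ := hsol_spec p.2 hr2
    -- the remainder is `−J(Q w₁ w₁ − Q w₂ w₂)`
    have hrem : sol p.1 - sol p.2 - A (p.1 - p.2) =
        -(J (Q (sol p.1) (sol p.1) - Q (sol p.2) (sol p.2))) := by
      conv_lhs => rw [← he₁, ← he₂]
      simp only [hΦ, map_sub]; abel
    rw [hrem, norm_neg]
    have hw12 : ‖sol p.1 - sol p.2‖ ≤ 2 * a * ‖p.1 - p.2‖ := hLip p.1 p.2 hr1 hr2
    have hw1 : ‖sol p.1‖ ≤ 2 * a * ‖p.1‖ := hbound p.1 hr1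
    have hw2 : ‖sol p.2‖ ≤ 2 * a * ‖p.2‖ := hbound p.2 hr2
    have hsmall : 8 * a ^ 2 * j * q * η ≤ c := by
      have h1 : η ≤ c / (8 * a ^ 2 * j * q + 1) := min_le_right _ _
      have h2 : 8 * a ^ 2 * j * q * η ≤ (8 * a ^ 2 * j * q + 1) * η := by nlinarith
      calc 8 * a ^ 2 * j * q * η ≤ (8 * a ^ 2 * j * q + 1) * η := h2
        _ ≤ (8 * a ^ 2 * j * q + 1) * (c / (8 * a ^ 2 * j * q + 1)) := by gcongr
        _ = c := by field_simp
    calc ‖J (Q (sol p.1) (sol p.1) - Q (sol p.2) (sol p.2))‖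
        ≤ j * ‖Q (sol p.1) (sol p.1) - Q (sol p.2) (sol p.2)‖ := J.le_opNorm _
      _ ≤ j * (q * (‖sol p.1‖ + ‖sol p.2‖) * ‖sol p.1 - sol p.2‖) := by
          gcongr; exact norm_bilinear_diag_sub_le Q _ _
      _ ≤ j * (q * (2 * a * ‖p.1‖ + 2 * a * ‖p.2‖) * (2 * a * ‖p.1 - p.2‖)) := by gcongr
      _ = (8 * a ^ 2 * j * q * ((‖p.1‖ + ‖p.2‖) / 2)) * ‖p.1 - p.2‖ := by ring
      _ ≤ (8 * a ^ 2 * j * q * η) * ‖p.1 - p.2‖ := by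
          gcongr
          linarith
      _ ≤ c * ‖p.1 - p.2‖ := by gcongr

end Literature.Analysis.Calculus

end
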